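import Mathlib.Analysis.Normed.Group.Constructions
import Mathlib.Analysis.Convex.PathConnected
import Literature.AlgebraicTopology.FundamentalGroup.CellAttachmentKernelLoop
import HarnessLib

/-!
# The boundary loop of the square `[-1, 1]²` in the sup norm: a simple closed curve generating `π₁`

Topic `Literature/AlgebraicTopology/FundamentalGroup`; companion of `CellAttachmentKernelLoop.lean`
(§3 there: the two standard ROUND parametrisations `unitCircleLoop`, `euclideanCircleLoop` of the
boundary of the unit disc).  Here: the POLYGONAL parametrisation of the boundary of the unit ball of
`ℝ² = (ι → ℝ)` (two indices `i₀ ≠ i₁`) for the sup norm — the square `[-1, 1]²` — by its four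
edges, based at the corner `(-1, -1)`:

* `SquareLoop.pt i₀ a b` — the point with `i₀`-coordinate `a` and other coordinate `b`;
* `SquareLoop.loop i₀` — the concatenation of the four edge segments
  `(-1,-1) → (1,-1) → (1,1) → (-1,1) → (-1,-1)` (Mathlib `Path.segment`, `Path.trans`), with the
  piecewise formulae `loop_apply_of_le_quarter` … `loop_apply_of_three_quarters_le`;
* `norm_loop` / `mem_range_loop` — it runs on, and onto, the unit sphere `{‖x‖ = 1}`;
* `loop_eq_iff` — it is injective except for `t = 0, 1` (a simple closed curve);
* **`zpowers_loop_eq_top`** — hence (Hatcher, Thm. 1.7, via the tree's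
  `zpowers_liftPath_eq_top_of_simpleClosed`) its class GENERATES `π₁({‖x‖ = 1}, (-1,-1))`.

Written for the punctured-torus computation `PuncturedTorusCommutator.lean` (the square is a
fundamental domain of `ℝ²/ℤ²` up to scaling, and its boundary word is a commutator).  Everything is
proved; the two definitions are the point and the loop.

## References

* A. Hatcher, *Algebraic Topology*, CUP (2002), Thm. 1.7 (p. 29); §1.2, the torus as a square
  with edges identified (p. 51, Example after Prop. 1.26). [HatcherAT2002]
-/

noncomputable section

open Set Function Metric Topology unitInterval

namespace Literature.AlgebraicTopology.FundamentalGroup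

namespace SquareLoop

variable {ι : Type*} [DecidableEq ι]

/-! ### Two-coordinate points -/

/-- The point of `ι → ℝ` with `i₀`-coordinate `a` and all other coordinates `b` (for
`ι = {i₀, i₁}`: the point `(a, b)`). [cite: HatcherAT2002, §1.2 p.51 (the torus as the square with edges identified); Thm. 1.7] -/
def pt (i₀ : ι) (a b : ℝ) : ι → ℝ := fun i => if i = i₀ then a else b

/-- The `i₀`-coordinate of `pt i₀ a b`. [cite: HatcherAT2002, §1.2 p.51 (the torus as the square with edges identified); Thm. 1.7] -/
@[simp] theorem pt_apply_self (i₀ : ι) (a b : ℝ) : pt i₀ a b i₀ = a := by simp [pt]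

/-- The other coordinates of `pt i₀ a b`. [cite: HatcherAT2002, §1.2 p.51 (the torus as the square with edges identified); Thm. 1.7] -/
theorem pt_apply_of_ne {i₀ i : ι} (h : i ≠ i₀) (a b : ℝ) : pt i₀ a b i = b := by simp [pt, h]

/-- With two indices, every point is a `pt`. [cite: HatcherAT2002, §1.2 p.51 (the torus as the square with edges identified); Thm. 1.7] -/
theorem eq_pt {i₀ i₁ : ι} (hne : i₀ ≠ i₁) (hall : ∀ i, i = i₀ ∨ i = i₁) (x : ι → ℝ) :
    x = pt i₀ (x i₀) (x i₁) := by
  funext i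
  rcases hall i with rfl | rfl
  · simp
  · rw [pt_apply_of_ne (Ne.symm hne)]

/-- Equality of two-coordinate points. [cite: HatcherAT2002, §1.2 p.51 (the torus as the square with edges identified); Thm. 1.7] -/
theorem pt_eq_pt_iff {i₀ i₁ : ι} (hne : i₀ ≠ i₁) {a b a' b' : ℝ} :
    pt i₀ a b = pt i₀ a' b' ↔ a = a' ∧ b = b' := by
  constructor
  · intro h
    refine ⟨by simpa using congrFun h i₀, ?_⟩
    have h' := congrFun h i₁
    rwa [pt_apply_of_ne (Ne.symm hne), pt_apply_of_ne (Ne.symm hne)] at h'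
  · rintro ⟨rfl, rfl⟩
    rfl

/-- Coordinates of a straight segment between two-coordinate points. [cite: HatcherAT2002, §1.2 p.51 (the torus as the square with edges identified); Thm. 1.7] -/
theorem segment_pt_apply (i₀ : ι) (a b a' b' : ℝ) (t : I) :
    Path.segment (pt i₀ a b) (pt i₀ a' b') t = pt i₀ (a + t * (a' - a)) (b + t * (b' - b)) := by
  rw [Path.segment_apply, AffineMap.lineMap_apply_module']
  funext i
  by_cases h : i = i₀
  · subst h; simp; ring
  · simp [pt_apply_of_ne h]; ring

/-! ### The square boundary loop -/

/-- **The boundary loop of the square `[-1,1]²`** (unit sphere of `ι → ℝ`, `ι = {i₀, i₁}`, for the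
sup norm), based at the corner `(-1,-1)`: the four edges
`(-1,-1) → (1,-1) → (1,1) → (-1,1) → (-1,-1)`, each traversed in time `1/4`.
[cite: HatcherAT2002, §1.2 p.51 (the torus as a square with edges identified)] -/
def loop (i₀ : ι) : Path (pt i₀ (-1) (-1)) (pt i₀ (-1) (-1)) :=
  ((Path.segment (pt i₀ (-1) (-1)) (pt i₀ 1 (-1))).trans
      (Path.segment (pt i₀ 1 (-1)) (pt i₀ 1 1))).trans
    ((Path.segment (pt i₀ 1 1) (pt i₀ (-1) 1)).trans
      (Path.segment (pt i₀ (-1) 1) (pt i₀ (-1) (-1))))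

variable (i₀ : ι)

/-- First edge: for `t ≤ 1/4`, `loop t = (8t - 1, -1)`. [cite: HatcherAT2002, §1.2 p.51 (the torus as the square with edges identified); Thm. 1.7] -/
theorem loop_apply_of_le_quarter {t : I} (ht : (t : ℝ) ≤ 1 / 4) :
    loop i₀ t = pt i₀ (8 * t - 1) (-1) := by
  rw [loop, Path.trans_apply, dif_pos (by linarith), Path.trans_apply, dif_pos
    (by change (2 : ℝ) * (t : ℝ) ≤ 1 / 2; linarith)]
  rw [segment_pt_apply]
  change pt i₀ (-1 + 2 * (2 * (t : ℝ)) * (1 - -1)) (-1 + 2 * (2 * (t : ℝ)) * (-1 - -1)) = _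
  congr 1 <;> ring

/-- Second edge: for `1/4 ≤ t ≤ 1/2`, `loop t = (1, 8t - 3)`. [cite: HatcherAT2002, §1.2 p.51 (the torus as the square with edges identified); Thm. 1.7] -/
theorem loop_apply_of_quarter_le_of_le_half {t : I} (ht₁ : 1 / 4 ≤ (t : ℝ)) (ht₂ : (t : ℝ) ≤ 1 / 2) :
    loop i₀ t = pt i₀ 1 (8 * t - 3) := by
  rw [loop, Path.trans_apply, dif_pos (by linarith), Path.trans_apply]
  by_cases h : (t : ℝ) = 1 / 4
  · rw [dif_pos (by change (2 : ℝ) * (t : ℝ) ≤ 1 / 2; linarith), segment_pt_apply]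
    change pt i₀ (-1 + 2 * (2 * (t : ℝ)) * (1 - -1)) (-1 + 2 * (2 * (t : ℝ)) * (-1 - -1)) = _
    rw [h]
    congr 1 <;> ring
  · rw [dif_neg (by change ¬ (2 : ℝ) * (t : ℝ) ≤ 1 / 2; intro h'; exact h (by linarith)),
      segment_pt_apply]
    change pt i₀ (1 + (2 * (2 * (t : ℝ)) - 1) * (1 - 1)) (-1 + (2 * (2 * (t : ℝ)) - 1) * (1 - -1)) = _
    congr 1 <;> ring

/-- Third edge: for `1/2 ≤ t ≤ 3/4`, `loop t = (5 - 8t, 1)`. [cite: HatcherAT2002, §1.2 p.51 (the torus as the square with edges identified); Thm. 1.7] -/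
theorem loop_apply_of_half_le_of_le_three_quarters {t : I} (ht₁ : 1 / 2 ≤ (t : ℝ))
    (ht₂ : (t : ℝ) ≤ 3 / 4) : loop i₀ t = pt i₀ (5 - 8 * t) 1 := by
  rw [loop, Path.trans_apply]
  by_cases h : (t : ℝ) = 1 / 2
  · rw [dif_pos h.le, Path.trans_apply,
      dif_neg (by change ¬ (2 : ℝ) * (t : ℝ) ≤ 1 / 2; linarith), segment_pt_apply]
    change pt i₀ (1 + (2 * (2 * (t : ℝ)) - 1) * (1 - 1)) (-1 + (2 * (2 * (t : ℝ)) - 1) * (1 - -1)) = _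
    rw [h]
    congr 1 <;> ring
  · rw [dif_neg (by intro h'; exact h (le_antisymm h' ht₁)), Path.trans_apply,
      dif_pos (by change (2 : ℝ) * (t : ℝ) - 1 ≤ 1 / 2; linarith),
      segment_pt_apply]
    change pt i₀ (1 + 2 * (2 * (t : ℝ) - 1) * (-1 - 1)) (1 + 2 * (2 * (t : ℝ) - 1) * (1 - 1)) = _
    congr 1 <;> ring

/-- Fourth edge: for `3/4 ≤ t`, `loop t = (-1, 7 - 8t)`. [cite: HatcherAT2002, §1.2 p.51 (the torus as the square with edges identified); Thm. 1.7] -/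
theorem loop_apply_of_three_quarters_le {t : I} (ht : 3 / 4 ≤ (t : ℝ)) :
    loop i₀ t = pt i₀ (-1) (7 - 8 * t) := by
  rw [loop, Path.trans_apply, dif_neg (by linarith), Path.trans_apply]
  by_cases h : (t : ℝ) = 3 / 4
  · rw [dif_pos (by change (2 : ℝ) * (t : ℝ) - 1 ≤ 1 / 2; linarith),
      segment_pt_apply]
    change pt i₀ (1 + 2 * (2 * (t : ℝ) - 1) * (-1 - 1)) (1 + 2 * (2 * (t : ℝ) - 1) * (1 - 1)) = _
    rw [h]
    congr 1 <;> ring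
  · have hlt : ¬ (2 : ℝ) * (t : ℝ) - 1 ≤ 1 / 2 := fun h' ↦ h (by linarith)
    rw [dif_neg hlt, segment_pt_apply]
    change pt i₀ (-1 + (2 * (2 * (t : ℝ) - 1) - 1) * (-1 - -1))
      (1 + (2 * (2 * (t : ℝ) - 1) - 1) * (-1 - 1)) = _
    congr 1 <;> ring

variable [Fintype ι]

omit [DecidableEq ι] in
/-- Sup-norm criterion: all coordinates of absolute value `≤ 1`, one of absolute value `1`, give
norm `1`. [cite: HatcherAT2002, §1.2 p.51 (the torus as the square with edges identified); Thm. 1.7] -/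
theorem norm_eq_one_of {x : ι → ℝ} (hle : ∀ i, |x i| ≤ 1) {i : ι} (hi : |x i| = 1) : ‖x‖ = 1 := by
  apply le_antisymm
  · exact (pi_norm_le_iff_of_nonneg zero_le_one).2 fun j ↦ by
      rw [Real.norm_eq_abs]; exact hle j
  · calc (1 : ℝ) = ‖x i‖ := by rw [Real.norm_eq_abs, hi]
      _ ≤ ‖x‖ := norm_le_pi_norm x i

/-- The sup norm of a two-coordinate point with `|a| ≤ 1`, `|b| = 1` is `1`. [cite: HatcherAT2002, §1.2 p.51 (the torus as the square with edges identified); Thm. 1.7] -/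
theorem norm_pt_eq_one_right {i₀ i₁ : ι} (hne : i₀ ≠ i₁) {a b : ℝ} (ha : |a| ≤ 1) (hb : |b| = 1) :
    ‖pt i₀ a b‖ = 1 := by
  refine norm_eq_one_of (fun i ↦ ?_) (i := i₁) (by rw [pt_apply_of_ne (Ne.symm hne)]; exact hb)
  by_cases h : i = i₀
  · subst h; simpa using ha
  · rw [pt_apply_of_ne h]; exact hb.le

/-- The sup norm of a two-coordinate point with `|a| = 1`, `|b| ≤ 1` is `1`. [cite: HatcherAT2002, §1.2 p.51 (the torus as the square with edges identified); Thm. 1.7] -/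
theorem norm_pt_eq_one_left {a b : ℝ} (i₀ : ι) (ha : |a| = 1) (hb : |b| ≤ 1) :
    ‖pt i₀ a b‖ = 1 := by
  refine norm_eq_one_of (fun i ↦ ?_) (i := i₀) (by simpa using ha)
  by_cases h : i = i₀
  · subst h; simp [ha.le]
  · rw [pt_apply_of_ne h]; exact hb

/-- The corner `(-1,-1)` lies on the unit sphere. [cite: HatcherAT2002, §1.2 p.51 (the torus as the square with edges identified); Thm. 1.7] -/
theorem corner_mem_sphere : pt i₀ (-1) (-1) ∈ sphere (0 : ι → ℝ) 1 := by
  rw [mem_sphere_zero_iff_norm]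
  exact norm_pt_eq_one_left i₀ (by norm_num) (by norm_num)

variable {i₀} {i₁ : ι} (hne : i₀ ≠ i₁) (hall : ∀ i, i = i₀ ∨ i = i₁)
include hne

/-- The square loop runs on the unit sphere of the sup norm. [cite: HatcherAT2002, §1.2 p.51 (the torus as the square with edges identified); Thm. 1.7] -/
theorem norm_loop (t : I) : ‖loop i₀ t‖ = 1 := by
  have h0 := t.2.1
  have h1 := t.2.2
  rcases le_or_gt (t : ℝ) (1 / 4) with ha | ha
  · rw [loop_apply_of_le_quarter i₀ ha]
    exact norm_pt_eq_one_right hne (abs_le.2 ⟨by linarith, by linarith⟩) (by norm_num)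
  rcases le_or_gt (t : ℝ) (1 / 2) with hb | hb
  · rw [loop_apply_of_quarter_le_of_le_half i₀ ha.le hb]
    exact norm_pt_eq_one_left i₀ (by norm_num) (abs_le.2 ⟨by linarith, by linarith⟩)
  rcases le_or_gt (t : ℝ) (3 / 4) with hc | hc
  · rw [loop_apply_of_half_le_of_le_three_quarters i₀ hb.le hc]
    exact norm_pt_eq_one_right hne (abs_le.2 ⟨by linarith, by linarith⟩) (by norm_num)
  · rw [loop_apply_of_three_quarters_le i₀ hc.le]
    exact norm_pt_eq_one_left i₀ (by norm_num) (abs_le.2 ⟨by linarith, by linarith⟩)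

/-- The square loop lies in the unit sphere. [cite: HatcherAT2002, §1.2 p.51 (the torus as the square with edges identified); Thm. 1.7] -/
theorem loop_mem_sphere (t : I) : loop i₀ t ∈ sphere (0 : ι → ℝ) 1 := by
  rw [mem_sphere_zero_iff_norm]; exact norm_loop hne t

include hall

/-- The square loop passes through every point of the unit sphere. [cite: HatcherAT2002, §1.2 p.51 (the torus as the square with edges identified); Thm. 1.7] -/
theorem mem_range_loop {x : ι → ℝ} (hx : ‖x‖ = 1) : x ∈ range (loop i₀) := by
  have ha : |x i₀| ≤ 1 := by rw [← Real.norm_eq_abs, ← hx]; exact norm_le_pi_norm x i₀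
  have hb : |x i₁| ≤ 1 := by rw [← Real.norm_eq_abs, ← hx]; exact norm_le_pi_norm x i₁
  rw [abs_le] at ha hb
  have hx' := eq_pt hne hall x
  -- one coordinate has absolute value `1`
  have hmax : |x i₀| = 1 ∨ |x i₁| = 1 := by
    by_contra hcon
    push Not at hcon
    have h1 : ∀ i, ‖x i‖ < 1 := by
      intro i
      rcases hall i with rfl | rfl
      · exact lt_of_le_of_ne (by rw [Real.norm_eq_abs]; exact abs_le.2 ha) (by
          rw [Real.norm_eq_abs]; exact hcon.1)
      · exact lt_of_le_of_ne (by rw [Real.norm_eq_abs]; exact abs_le.2 hb) (by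
          rw [Real.norm_eq_abs]; exact hcon.2)
    have : ‖x‖ < 1 := (pi_norm_lt_iff zero_lt_one).2 h1
    linarith
  rcases hmax with h | h
  · rcases (abs_eq zero_le_one).1 h with h' | h'
    · -- `x i₀ = 1`: second edge, `t = (x i₁ + 3)/8`
      refine ⟨⟨(x i₁ + 3) / 8, by constructor <;> linarith⟩, ?_⟩
      rw [loop_apply_of_quarter_le_of_le_half i₀ (show (1 : ℝ) / 4 ≤ (x i₁ + 3) / 8 by linarith)
        (show (x i₁ + 3) / 8 ≤ (1 : ℝ) / 2 by linarith)]
      conv_rhs => rw [hx']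
      rw [pt_eq_pt_iff hne]
      exact ⟨by linarith, by change 8 * ((x i₁ + 3) / 8) - 3 = x i₁; ring⟩
    · -- `x i₀ = -1`: fourth edge, `t = (7 - x i₁)/8`
      refine ⟨⟨(7 - x i₁) / 8, by constructor <;> linarith⟩, ?_⟩
      rw [loop_apply_of_three_quarters_le i₀ (show (3 : ℝ) / 4 ≤ (7 - x i₁) / 8 by linarith)]
      conv_rhs => rw [hx']
      rw [pt_eq_pt_iff hne]
      exact ⟨by linarith, by change 7 - 8 * ((7 - x i₁) / 8) = x i₁; ring⟩
  · rcases (abs_eq zero_le_one).1 h with h' | h'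
    · -- `x i₁ = 1`: third edge, `t = (5 - x i₀)/8`
      refine ⟨⟨(5 - x i₀) / 8, by constructor <;> linarith⟩, ?_⟩
      rw [loop_apply_of_half_le_of_le_three_quarters i₀
        (show (1 : ℝ) / 2 ≤ (5 - x i₀) / 8 by linarith) (show (5 - x i₀) / 8 ≤ (3 : ℝ) / 4 by linarith)]
      conv_rhs => rw [hx']
      rw [pt_eq_pt_iff hne]
      exact ⟨by change 5 - 8 * ((5 - x i₀) / 8) = x i₀; ring, by linarith⟩
    · -- `x i₁ = -1`: first edge, `t = (x i₀ + 1)/8`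
      refine ⟨⟨(x i₀ + 1) / 8, by constructor <;> linarith⟩, ?_⟩
      rw [loop_apply_of_le_quarter i₀ (show (x i₀ + 1) / 8 ≤ (1 : ℝ) / 4 by linarith)]
      conv_rhs => rw [hx']
      rw [pt_eq_pt_iff hne]
      exact ⟨by change 8 * ((x i₀ + 1) / 8) - 1 = x i₀; ring, by linarith⟩

omit [Fintype ι] hall in
/-- **The square loop is a simple closed curve**: injective except for `t = 0, 1`. [cite: HatcherAT2002, §1.2 p.51 (the torus as the square with edges identified); Thm. 1.7] -/
theorem loop_eq_iff (s t : I) (h : loop i₀ s = loop i₀ t) :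
    s = t ∨ (s = 0 ∧ t = 1) ∨ (s = 1 ∧ t = 0) := by
  have hs0 := s.2.1; have hs1 := s.2.2; have ht0 := t.2.1; have ht1 := t.2.2
  -- reduce to real (in)equalities
  suffices H : (s : ℝ) = t ∨ ((s : ℝ) = 0 ∧ (t : ℝ) = 1) ∨ ((s : ℝ) = 1 ∧ (t : ℝ) = 0) by
    rcases H with H | ⟨H1, H2⟩ | ⟨H1, H2⟩
    · exact Or.inl (Subtype.ext H)
    · exact Or.inr (Or.inl ⟨Subtype.ext H1, Subtype.ext H2⟩)
    · exact Or.inr (Or.inr ⟨Subtype.ext H1, Subtype.ext H2⟩)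
  -- the four edges of `s` against the four edges of `t`
  rcases le_or_gt (s : ℝ) (1 / 4) with hs | hs <;>
  [rw [loop_apply_of_le_quarter i₀ hs] at h;
    (rcases le_or_gt (s : ℝ) (1 / 2) with hs' | hs' <;>
    [rw [loop_apply_of_quarter_le_of_le_half i₀ hs.le hs'] at h;
      (rcases le_or_gt (s : ℝ) (3 / 4) with hs'' | hs'' <;>
      [rw [loop_apply_of_half_le_of_le_three_quarters i₀ hs'.le hs''] at h;
        rw [loop_apply_of_three_quarters_le i₀ hs''.le] at h])])] <;>
  (rcases le_or_gt (t : ℝ) (1 / 4) with ht | ht <;>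
  [rw [loop_apply_of_le_quarter i₀ ht] at h;
    (rcases le_or_gt (t : ℝ) (1 / 2) with ht' | ht' <;>
    [rw [loop_apply_of_quarter_le_of_le_half i₀ ht.le ht'] at h;
      (rcases le_or_gt (t : ℝ) (3 / 4) with ht'' | ht'' <;>
      [rw [loop_apply_of_half_le_of_le_three_quarters i₀ ht'.le ht''] at h;
        rw [loop_apply_of_three_quarters_le i₀ ht''.le] at h])])]) <;>
  (rw [pt_eq_pt_iff hne] at h; obtain ⟨h₁, h₂⟩ := h) <;>
  first
  | exact Or.inl (by linarith)
  | exact Or.inr (Or.inl ⟨by linarith, by linarith⟩)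
  | exact Or.inr (Or.inr ⟨by linarith, by linarith⟩)

/-- **The square loop generates the fundamental group of the square's boundary** (the unit
sphere of the sup norm on `ℝ²`), based at the corner `(-1,-1)`: Hatcher's Thm. 1.7 transported
along the homeomorphism with `ℝ/ℤ` given by the simple closed curve `loop`
(`zpowers_liftPath_eq_top_of_simpleClosed`). [cite: HatcherAT2002, Thm. 1.7 (p. 29)] -/
theorem zpowers_loop_eq_top :
    Subgroup.zpowers (_root_.FundamentalGroup.fromPath
      (Path.Homotopic.Quotient.mk
        (VanKampen.liftPath (sphere (0 : ι → ℝ) 1) (loop i₀) (loop_mem_sphere hne))) :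
        _root_.FundamentalGroup ↥(sphere (0 : ι → ℝ) 1)
          ⟨pt i₀ (-1) (-1), corner_mem_sphere i₀⟩) = ⊤ :=
  zpowers_liftPath_eq_top_of_simpleClosed (loop i₀) (loop_eq_iff hne) (loop_mem_sphere hne)
    (fun _ hx ↦ mem_range_loop hne hall (mem_sphere_zero_iff_norm.1 hx)) (corner_mem_sphere i₀)

end SquareLoop

end Literature.AlgebraicTopology.FundamentalGroup

end
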